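import Mathlib
import HarnessLib
import Summits.Langlands.Langlands.Theses.G2ShadowRankSeven

/-!
# Birth skeleton (BC3) for crux stmt-Langlands-18288
`Summit.Langlands.Langlands.Theses.G2ShadowRankSeven.NoShadowLineAdmissible` — line `birth`

Route `route-Langlands-G2ShadowRankSeven` (`closes (hAsm : Assembly) (hA : NoShadowLineAdmissible)
(hB : LineOrIrreducibleAdmissible) (hC : GenericWeightCofinite) (hJ : RankSevenToLanglands) : Langlands`;
this crux is `hA`, rank 2, the route's binding input).  THE CRUX: for every regular L-algebraic cuspidal `π`
on `GL₇(𝔸_ℚ)`, essentially self-dual at Satake level, whose infinity type is G₂-ADMISSIBLE (z-exponents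
`{c, c ± p, c ± q, c ± (p+q)}`), there is a finite set `S` of primes such that for `ℓ ∉ S`, every
`ι : ℚ̄_ℓ ≃ ℂ` and every framed `ρ : Γ_ℚ → GL₇(ℚ̄_ℓ)` Satake–Frobenius compatible with `(π, ι)` at almost
all places has NO one-dimensional subquotient (no subrepresentations `W' < W` with
`dim W = dim W' + 1`) — this excludes the `SL₃`-shadow `σ ⊕ σ^∨ ⊕ χ` and `Ind σ ⊕ χ` and is robust to
non-semisimple avatars.

This file concludes the crux BY NAME from two named stubs, cut along the route's own foreseen split
(`A ⇐ SemisimpleCompanionLine → NoStableLineSemisimple → A`, route header TWO-LAYER PLAN), and carries the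
route's BC5 rung as a third named stub (plan-only witness of weakness, T3), sharpened as the skeleton
vet advised (SKELVET.md 2026-08-17: "π₂ any cuspidal GL₂ is over-broad — suggest π₂ cohomological"):

* `stub_semisimpleCompanionLine` (M, provable now) — SEMISIMPLE COMPANION WITH A LINE: for any cuspidal
  `π` on `GL₇(𝔸_ℚ)`, any `ℓ`, `ι`, and any framed `ρ` Satake–Frobenius compatible with `(π, ι)` almost
  everywhere that HAS a one-dimensional subquotient `W/W'`, there is a framed `ρ'` which is again
  compatible almost everywhere, is SEMISIMPLE, and has a one-dimensional SUBrepresentation.  On paper: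
  semisimplify along the stable flag `0 ≤ W' < W ≤ ℚ̄_ℓ⁷` (continuous dévissage, block by block, as in
  the tree's every-rank `FramedGaloisRep.exists_semisimplification`, Deligne–Serre 1974, 6.12): Frobenius
  characteristic polynomials and unramifiedness are kept (so `SatakeFrobCompatibleAt` is kept verbatim),
  and the `1 × 1` block `W/W'` survives as a direct summand.  Why it might fail as typed: only if the
  block-diagonal companion could not be chosen continuous for the units topology — it can (same proof as
  the accepted Literature theorem).
* `stub_noStableLineSemisimple` (THE HEART, open) — for `π` exactly as in the crux (regular, L-algebraic,
  essentially self-dual at Satake level, G₂-admissible weight): cofinitely in `ℓ`, no compatible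
  SEMISIMPLE framed avatar has a one-dimensional subrepresentation.  This is the shadow exclusion proper
  (Feng–Whitmore arXiv:2507.22631 §1.3, Dai arXiv:2510.12496 Thm 1.1's G₂ exception): the route's levers
  L-C (residual endoscopic descent to `PGL₃` + Fontaine–Laffaille lifting over a CM quadratic field,
  arXiv:1812.09999 Thm 6.1.2) and L-B (eigenvariety reducibility loci, adjoint Selmer without enormous
  image) attack THIS statement and nothing else; it does not give the crux back without stub 1 (the crux
  quantifies over non-semisimple avatars), and it is not the summit (rank 7, `ℚ`, one weight locus,
  cofinite `ℓ`, irreducibility clause only).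
* `stub_rung_symmetricSixthPower` (BC5 rung, plan-only; NOT consumed by the composition) — the crux's
  conclusion for ALL `ℓ` on the principal-`SL₂` sub-locus: if moreover there is a REGULAR ALGEBRAIC
  (cohomological — the vet's sharpening) cuspidal `π₂` on `GL₂(𝔸_ℚ)`, not of CM type at Satake level, with
  `t_{π,v} = Sym⁶(t_{π₂,v})` at almost all `v`, then every compatible framed avatar of `π`, at every `ℓ`,
  has no one-dimensional subquotient.  (`Sym⁶` weights `{6a, 5a+b, …, 6b}` ARE G₂-admissible:
  `c = 3a+3b`, `p = a−b`, `q = 2(a−b)`; the technique: `ρ^ss ≅ Sym⁶ ρ_{π₂,ℓ}` by Chebotarev +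
  Brauer–Nesbitt, and `Sym⁶ ρ_{π₂,ℓ}` is irreducible for every `ℓ` by Ribet–Momose open image for non-CM
  regular algebraic `π₂`; a regime where the summit's clause (B) and the general rank-7 cell are not
  known.)  Why it might fail: only through the Satake-level rendering of "π₂ non-CM" (a self-twist by a
  Hecke character non-trivial at infinitely many places) — the intended reading.

The composition `NoShadowLineAdmissible_of` is kernel-checked and sorry-free: take the cofinite set `S`
of stub 2; for `ℓ ∉ S` and a compatible `ρ` with a one-dimensional subquotient, stub 1 produces a
compatible semisimple `ρ'` with a line, which stub 2 forbids.

Shape (for `ledger skeleton check` / `#h21_check_skeleton`): each stub is `theorem stub_<name> : <Prop> :=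
by sorry` (closed statements over existing declarations only); `_Goal.stub_<name> : Prop := type_of%
@stub_<name>` names that statement; `NoShadowLineAdmissible_of (h₁ : _Goal.stub_semisimpleCompanionLine)
(h₂ : _Goal.stub_noStableLineSemisimple) : NoShadowLineAdmissible` concludes the route decl BY NAME; the
last `example` feeds the two stubs to it.  Sorries: exactly 3, one inside each `stub_*`, none elsewhere.

Disproof used: none exists — `ledger crux ls stmt-Langlands-18288` lists no workfiles (no `Disproof.lean`,
no `Negative/` lemma, no dead line, no crux ideas) at registration time (2026-08-17); `ledger negatives
--problem Langlands` (4 entries: SplitPrimeInductionMonomialSerreAtSplitPrimes, SplitPrimeInductionDeinduction,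
OrdinaryPrimeTransportRankinSelbergPoleCount — an `n = 0` degenerate-rank artefact, impossible here since
the rank is the literal `7` —, K3KugaSatakeDescentSerreTypeAnchor) contains nothing of the shape of these
stubs.  Provenance: stubs 1–2 are, verbatim, the stubs registered with the route's birth certificate
(planner-plan-lens3-Langlands-nearmiss-g3-0, `ledger skeleton check` 2026-08-17T15:01:44Z, vetted PASS by
refuter-skel-stmt-Langlands-18288-vet-0); stub 3 is that registration's rung with the vet's advisory
applied (`π₂.1.IsRegularAlgebraic` added); this file is their first copy in the tree (`Lines/birth.lean`).
-/

set_option linter.dupNamespace false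

noncomputable section

namespace Summit.Langlands.Langlands.Cruxes.NoShadowLineAdmissible.Birth

open Summit.Langlands.Langlands.Theses.G2ShadowRankSeven
open Literature.NumberTheory.Automorphic Literature.NumberTheory.GaloisRepresentations
open NumberField IsDedekindDomain
open scoped NumberField
open Filter

/-! ## 1. The stubs -/

/-- **STUB 1 — semisimple companion with a line** (provable now, size M).  For any cuspidal `π` on
`GL₇(𝔸_ℚ)`, any prime `ℓ`, `ι : ℚ̄_ℓ ≃ ℂ` and any framed `ρ : Γ_ℚ → GL₇(ℚ̄_ℓ)` which is Satake–Frobenius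
compatible with `(π, ι)` at almost all places and has a one-dimensional subquotient (subrepresentations
`W' < W` with `dim W = dim W' + 1`), there is a framed `ρ'` which is Satake–Frobenius compatible with
`(π, ι)` at almost all places, SEMISIMPLE, and has a one-dimensional subrepresentation.  Proof on paper:
continuous dévissage along the stable flag `W' < W` (blocks `W'`, `W/W'`, `V/W`), semisimplify the outer
blocks and take the block-diagonal sum — characteristic polynomials of Frobenius and triviality on inertia
are preserved (cf. the accepted every-rank `FramedGaloisRep.exists_semisimplification`), and the middle
`1 × 1` block is a stable line of the sum.  Why it might fail: it cannot as typed (pure representation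
theory over the topological field `ℚ̄_ℓ`); the only work is continuity in the units topology, already
done in the tree for the two-step dévissage.
[cite: DeligneSerreASENS1974, 6.12] [cite: BourbakiAlgebreVIII2012, § 20 n° 6] -/
theorem stub_semisimpleCompanionLine : ∀ (hcpt : isCompact_glFiniteIntegralLevel 7 ℚ) (π : CuspidalAutomorphicRepData 7 ℚ hcpt), ∀ (ℓ : ℕ) [Fact ℓ.Prime] (ι : PadicAlgCl ℓ ≃+* ℂ) (ρ : FramedGaloisRep ℚ (PadicAlgCl ℓ) 7), (∀ᶠ v : HeightOneSpectrum (𝓞 ℚ) in Filter.cofinite, Summit.Langlands.SatakeFrobCompatibleAt ι π.1 ρ v) → (∃ W W' : Subrepresentation ρ.toGaloisRep.toRepresentation, W' < W ∧ Module.finrank (PadicAlgCl ℓ) W.toSubmodule = Module.finrank (PadicAlgCl ℓ) W'.toSubmodule + 1) → ∃ ρ' : FramedGaloisRep ℚ (PadicAlgCl ℓ) 7, (∀ᶠ v : HeightOneSpectrum (𝓞 ℚ) in Filter.cofinite, Summit.Langlands.SatakeFrobCompatibleAt ι π.1 ρ' v) ∧ ρ'.toGaloisRep.IsSemisimple ∧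 (∃ W : Subrepresentation ρ'.toGaloisRep.toRepresentation, Module.finrank (PadicAlgCl ℓ) W.toSubmodule = 1) := by
  sorry

/-- **STUB 2 — no stable line in a semisimple avatar (THE HEART; open).**  For `π` regular, L-algebraic,
cuspidal on `GL₇(𝔸_ℚ)`, essentially self-dual at Satake level (`t_π⁻¹ = η · t_π` a.e. for a Hecke
character `η`) and of G₂-ADMISSIBLE infinity type (`{c, c ± p, c ± q, c ± (p+q)}` at the embedding
`ℚ → ℂ`): there is a finite set `S` of primes such that for `ℓ ∉ S`, every `ι` and every framed `ρ`
Satake–Frobenius compatible with `(π, ι)` almost everywhere which is SEMISIMPLE has no one-dimensional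
subrepresentation.  This is the exclusion of the `SL₃`-shadow `σ ⊕ σ^∨ ⊕ χ` (and of `Ind σ ⊕ χ`) named as
the binding input by Feng–Whitmore (arXiv:2507.22631 §1.3: "existing potential automorphy theorems seem
to be insufficient") and excepted by Dai (arXiv:2510.12496 Thm 1.1, Lie type G₂); the route's levers:
(L-C) `SL₃ = ` dual group of the elliptic endoscopic `PGL₃ ⊂ G₂`, residual endoscopic descent of `σ̄`
followed by Fontaine–Laffaille automorphy lifting over a CM quadratic field (arXiv:1812.09999 Thm 6.1.2)
to put `σ` in a compatible system and contradict Serre–Hui `λ`-independence at a Lie-irreducible `λ₀`;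
(L-B) anti-ordinary refinements on the definite `Sp(3)` eigenvariety (Bellaïche–Chenevier) and an
adjoint-Selmer vanishing theorem without enormous image.  Why it might fail: a G₂-type `π`
(Khare–Larsen–Savin, Dettweiler–Reiter) whose avatars carry the shadow at infinitely many `λ` refutes it
together with the irreducibility conjecture; every printed tool is blind to the shadow (same formal
bi-character as G₂, non-polarisable rank-3 pieces of non-consecutive weight).
[cite: FengWhitmore2025, §1.3] [cite: Dai2025, Thm. 1.1] [cite: AllenCalegariCaraianiGeeEtAl2023, Thm. 6.1.2] -/
theorem stub_noStableLineSemisimple : ∀ (hcpt : isCompact_glFiniteIntegralLevel 7 ℚ) (π : CuspidalAutomorphicRepData 7 ℚ hcpt) (T : InfinityType ℚ 7), π.1.HasInfinityType T → T.IsRegular → T.IsLAlgebraic → (∃ (h1 : isCompact_glFiniteIntegralLevel 1 ℚ) (η : CuspidalAutomorphicRepData 1 ℚ h1), ∀ᶠ v : HeightOneSpectrum (𝓞 ℚ) in Filter.cofinite, ∀ α : Multiset ℂ, π.1.HasSatakeParamAt v α → ∃ e : ℂ, η.1.HasSatakeParamAt v {e} ∧ α.map (fun a => a⁻¹) = α.map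 (fun a => e * a)) → (∀ σ : ℚ →+* ℂ, ∃ c p q : ℂ, (T σ).map ArchWeight.a = {c, c + p, c - p, c + q, c - q, c + (p + q), c - (p + q)}) → ∃ S : Finset ℕ, ∀ (ℓ : ℕ) [Fact ℓ.Prime], ℓ ∉ S → ∀ (ι : PadicAlgCl ℓ ≃+* ℂ) (ρ : FramedGaloisRep ℚ (PadicAlgCl ℓ) 7), (∀ᶠ v : HeightOneSpectrum (𝓞 ℚ) in Filter.cofinite, Summit.Langlands.SatakeFrobCompatibleAt ι π.1 ρ v) → ρ.toGaloisRep.IsSemisimple → ¬ (∃ W : Subrepresentation ρ.toGaloisRep.toRepresentation, Module.finrank (PadicAlgCl ℓ) W.toSubmodule = 1) := by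
  sorry

/-- **STUB 3 — BC5 rung (plan-only witness of weakness; not consumed by the composition): the
symmetric-sixth-power locus, ALL `ℓ`.**  For `π` exactly as in the crux, assume moreover a REGULAR
ALGEBRAIC cuspidal `π₂` on `GL₂(𝔸_ℚ)` (cohomological: the skeleton vet's sharpening of the registered
rung, which allowed any cuspidal `π₂`), not of CM type at Satake level (no Hecke character `θ`,
non-trivial at infinitely many places, with `θ_v · t_{π₂,v} = t_{π₂,v}` a.e.), with
`t_{π,v} = Sym⁶(t_{π₂,v}) = {b₁ⁱ b₂^{6-i}}_{i=0..6}` at almost all `v`.  Then for EVERY prime `ℓ`, every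
`ι` and every framed `ρ` Satake–Frobenius compatible with `(π, ι)` almost everywhere, `ρ` has no
one-dimensional subquotient.  Technique (named): `ρ^ss ≅ Sym⁶ ρ_{π₂,ι}` by Chebotarev density +
Brauer–Nesbitt (the tree's `FramedGaloisRep.nonempty_equiv_of_hasFrobCharpolyAt_eventually`-shape
argument), `ρ_{π₂,ι}` has open image containing an open subgroup of `SL₂(ℤ_ℓ)` for EVERY `ℓ`
(Ribet 1977/1985, Momose 1981: non-CM regular algebraic `π₂`), hence `Sym⁶ ρ_{π₂,ι}` is irreducible,
hence so is `ρ`, hence no `W' < W` of codimension one.  `Sym⁶` weights `{6a, 5a+b, …, 6b}` are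
G₂-admissible (`c = 3(a+b)`, `p = a-b`, `q = 2(a-b)`), so the rung lies ON the crux's weight locus and
outside the summit's known regime (clause (B) and the general rank-7 G₂ cell are open).  Why it might
fail: only through the Satake-level rendering of "non-CM" — the intended one (a CM `π₂` has a self-twist
by the quadratic character, non-trivial at a positive density of places).
[cite: Ribet1985, Thm. 3.1] [cite: Momose1981, Thm. 4.2] [cite: DeligneSerreASENS1974, Lemme 8.5] -/
theorem stub_rung_symmetricSixthPower : ∀ (hcpt : isCompact_glFiniteIntegralLevel 7 ℚ) (π : CuspidalAutomorphicRepData 7 ℚ hcpt) (T : InfinityType ℚ 7), π.1.HasInfinityType T → T.IsRegular → T.IsLAlgebraic → (∃ (h1 : isCompact_glFiniteIntegralLevel 1 ℚ) (η : CuspidalAutomorphicRepData 1 ℚ h1), ∀ᶠ v : HeightOneSpectrum (𝓞 ℚ) in Filter.cofinite, ∀ α : Multiset ℂ, π.1.HasSatakeParamAt v α → ∃ e : ℂ, η.1.HasSatakeParamAt v {e} ∧ α.map (fun a => a⁻¹) = α.map (fun a => e * a)) → (∀ σ : ℚ →+* ℂ, ∃ c p q : ℂ, (T σ).map ArchWeight.a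 = {c, c + p, c - p, c + q, c - q, c + (p + q), c - (p + q)}) → (∃ (h2 : isCompact_glFiniteIntegralLevel 2 ℚ) (π₂ : CuspidalAutomorphicRepData 2 ℚ h2), π₂.1.IsRegularAlgebraic ∧ (¬ ∃ (h1 : isCompact_glFiniteIntegralLevel 1 ℚ) (θ : CuspidalAutomorphicRepData 1 ℚ h1), (¬ ∀ᶠ v : HeightOneSpectrum (𝓞 ℚ) in Filter.cofinite, θ.1.HasSatakeParamAt v {1}) ∧ ∀ᶠ v : HeightOneSpectrum (𝓞 ℚ) in Filter.cofinite, ∀ β : Multiset ℂ, ∀ t : ℂ, π₂.1.HasSatakeParamAt v β → θ.1.HasSatakeParamAt v {t} → β.map (fun b => t * b) = β) ∧ ∀ᶠ v : HeightOneSpectrum (𝓞 ℚ) in Filter.cofinite, ∀ (α β : Multiset ℂ), π.1.HasSatakeParamAt v α → π₂.1.HasSatakeParamAt v β → ∃ b₁ b₂ : ℂ, β = {b₁, b₂} ∧ α = (Multiset.range 7).map (fun i => b₁ ^ i * b₂ ^ (6 - i))) → ∀ (ℓ : ℕ) [Fact ℓ.Prime] (ι : PadicAlgCl ℓ ≃+*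 ℂ) (ρ : FramedGaloisRep ℚ (PadicAlgCl ℓ) 7), (∀ᶠ v : HeightOneSpectrum (𝓞 ℚ) in Filter.cofinite, Summit.Langlands.SatakeFrobCompatibleAt ι π.1 ρ v) → ¬ (∃ W W' : Subrepresentation ρ.toGaloisRep.toRepresentation, W' < W ∧ Module.finrank (PadicAlgCl ℓ) W.toSubmodule = Module.finrank (PadicAlgCl ℓ) W'.toSubmodule + 1) := by
  sorry

/-! ## 2. The stub statements as named propositions (the composition's hypotheses, by name)

`_Goal` is internal on purpose: audits listing the file's declarations by short name find the `stub_*`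
THEOREMS, while `#h21_check_skeleton` accepts the hypotheses of `NoShadowLineAdmissible_of` by the stub
names they carry.  Each `_Goal.stub_x` is `type_of% @stub_x` — no text duplicated, no `sorry` inherited. -/

namespace _Goal

/-- The statement of `stub_semisimpleCompanionLine`, as a named `Prop` (literally its type). [folklore] -/
def stub_semisimpleCompanionLine : Prop :=
  type_of% @Summit.Langlands.Langlands.Cruxes.NoShadowLineAdmissible.Birth.stub_semisimpleCompanionLine

/-- The statement of `stub_noStableLineSemisimple`, as a named `Prop` (literally its type). [folklore] -/
def stub_noStableLineSemisimple : Prop :=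
  type_of% @Summit.Langlands.Langlands.Cruxes.NoShadowLineAdmissible.Birth.stub_noStableLineSemisimple

/-- The statement of `stub_rung_symmetricSixthPower`, as a named `Prop` (literally its type). [folklore] -/
def stub_rung_symmetricSixthPower : Prop :=
  type_of% @Summit.Langlands.Langlands.Cruxes.NoShadowLineAdmissible.Birth.stub_rung_symmetricSixthPower

end _Goal

/-! ## 3. The composition (kernel-checked, no `sorry`): companion → heart → crux by name -/

/-- **`NoShadowLineAdmissible` from stubs 1–2.**  Take the cofinite exceptional set `S` of stub 2 for
`(π, T, η)`; for `ℓ ∉ S`, `ι`, and a compatible framed `ρ` with a one-dimensional subquotient, stub 1 gives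
a compatible SEMISIMPLE `ρ'` with a one-dimensional subrepresentation, contradicting stub 2 at `ρ'`.
The hypotheses are, by name, the statements of `stub_semisimpleCompanionLine` and
`stub_noStableLineSemisimple`; the conclusion is the route decl. [folklore] -/
theorem NoShadowLineAdmissible_of (h₁ : _Goal.stub_semisimpleCompanionLine)
    (h₂ : _Goal.stub_noStableLineSemisimple) : NoShadowLineAdmissible := by
  unfold _Goal.stub_semisimpleCompanionLine at h₁
  unfold _Goal.stub_noStableLineSemisimple at h₂
  intro hcpt π T hT hreg hL hsd hadm
  -- the heart: a cofinite set of primes beyond which no compatible semisimple avatar has a stable line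
  obtain ⟨S, hS⟩ := h₂ hcpt π T hT hreg hL hsd hadm
  refine ⟨S, ?_⟩
  intro ℓ _ hℓ ι ρ hρ hline
  -- the semisimple companion of `ρ` keeps compatibility and acquires a stable line
  obtain ⟨ρ', hρ', hss, hW⟩ := h₁ hcpt π ℓ ι ρ hρ hline
  exact hS ℓ hℓ ι ρ' hρ' hss hW

/-- **The rung implies the crux's conclusion on its locus, uniformly in `ℓ`** (sanity link between stub 3
and the crux's conclusion: same `(π, T, η, weight)` binders, same conclusion, `S = ∅`).  Not a proof of the
crux (the `Sym⁶` hypothesis is extra) and not used by `NoShadowLineAdmissible_of`. [folklore] -/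
theorem noLine_allPrimes_of_rung (h₃ : _Goal.stub_rung_symmetricSixthPower) :
    ∀ (hcpt : isCompact_glFiniteIntegralLevel 7 ℚ) (π : CuspidalAutomorphicRepData 7 ℚ hcpt)
      (T : InfinityType ℚ 7), π.1.HasInfinityType T → T.IsRegular → T.IsLAlgebraic →
      (∃ (h1 : isCompact_glFiniteIntegralLevel 1 ℚ) (η : CuspidalAutomorphicRepData 1 ℚ h1),
        ∀ᶠ v : HeightOneSpectrum (𝓞 ℚ) in Filter.cofinite, ∀ α : Multiset ℂ, π.1.HasSatakeParamAt v α →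
          ∃ e : ℂ, η.1.HasSatakeParamAt v {e} ∧ α.map (fun a => a⁻¹) = α.map (fun a => e * a)) →
      (∀ σ : ℚ →+* ℂ, ∃ c p q : ℂ, (T σ).map ArchWeight.a =
        {c, c + p, c - p, c + q, c - q, c + (p + q), c - (p + q)}) →
      (∃ (h2 : isCompact_glFiniteIntegralLevel 2 ℚ) (π₂ : CuspidalAutomorphicRepData 2 ℚ h2),
        π₂.1.IsRegularAlgebraic ∧
        (¬ ∃ (h1 : isCompact_glFiniteIntegralLevel 1 ℚ) (θ : CuspidalAutomorphicRepData 1 ℚ h1),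
          (¬ ∀ᶠ v : HeightOneSpectrum (𝓞 ℚ) in Filter.cofinite, θ.1.HasSatakeParamAt v {1}) ∧
          ∀ᶠ v : HeightOneSpectrum (𝓞 ℚ) in Filter.cofinite, ∀ β : Multiset ℂ, ∀ t : ℂ,
            π₂.1.HasSatakeParamAt v β → θ.1.HasSatakeParamAt v {t} → β.map (fun b => t * b) = β) ∧
        ∀ᶠ v : HeightOneSpectrum (𝓞 ℚ) in Filter.cofinite, ∀ (α β : Multiset ℂ),
          π.1.HasSatakeParamAt v α → π₂.1.HasSatakeParamAt v β →
            ∃ b₁ b₂ : ℂ, β = {b₁, b₂} ∧ α = (Multiset.range 7).map (fun i => b₁ ^ i * b₂ ^ (6 - i))) →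
      ∃ S : Finset ℕ, ∀ (ℓ : ℕ) [Fact ℓ.Prime], ℓ ∉ S → ∀ (ι : PadicAlgCl ℓ ≃+* ℂ)
        (ρ : FramedGaloisRep ℚ (PadicAlgCl ℓ) 7),
        (∀ᶠ v : HeightOneSpectrum (𝓞 ℚ) in Filter.cofinite, Summit.Langlands.SatakeFrobCompatibleAt ι π.1 ρ v) →
        ¬ (∃ W W' : Subrepresentation ρ.toGaloisRep.toRepresentation, W' < W ∧
            Module.finrank (PadicAlgCl ℓ) W.toSubmodule = Module.finrank (PadicAlgCl ℓ) W'.toSubmodule + 1) := by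
  unfold _Goal.stub_rung_symmetricSixthPower at h₃
  intro hcpt π T hT hreg hL hsd hadm hsym
  exact ⟨∅, fun ℓ _ _ ι ρ hρ => h₃ hcpt π T hT hreg hL hsd hadm hsym ℓ ι ρ hρ⟩

/-- By-name sanity check (an `example`, not a declaration of the file): the two load-bearing stubs feed
the composition as they stand. -/
example : NoShadowLineAdmissible :=
  NoShadowLineAdmissible_of stub_semisimpleCompanionLine stub_noStableLineSemisimple

end Summit.Langlands.Langlands.Cruxes.NoShadowLineAdmissible.Birth

end
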